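import Summits.MatrixMultiplication.MatrixMultiplication.Theses.GLnSeparatingDesigns

/-!
# Sketch — crux-ideate round 2, ideator 4, crux `BorderHalfDimensionDesigns`

First lemmas / typed transfers for the two idea cards of this seat:

* card `subalgebra-middle-localisation`: `affine_localisation` (aliens of a target lie in the
  affine half-dimensional slice through it when the middle set sits in a two-sided translate of a
  unital subalgebra) and the transfer `SubalgebraMiddleDesigns` (the crux with that side
  condition; it implies the crux by forgetting the side condition: `border_of_subalgebraMiddle`).
* card `lie-patch-pole-order` (negation lens): the combinatorial core `diagIndicator_totalDegree_le`
  of the pole-order lemma (any polynomial agreeing with the off-diagonal indicator on a grid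
  `S^m × S^m`, `|S| = q`, has total degree `≥ m (q-1)`).
-/

namespace Summit.MatrixMultiplication.MatrixMultiplication.Cruxes.BorderHalfDimensionDesigns.Ideate4

open scoped BigOperators Matrix

abbrev GLn (n : ℕ) := Matrix.GeneralLinearGroup (Fin n) ℂ

/-- **Affine localisation** (card `subalgebra-middle-localisation`, first lemma).
If the middle set lives in a two-sided translate `g⁻¹ 𝔎 h⁻¹` of a unital subalgebra
`𝔎 ⊆ Mat_n(ℂ)`, then every sampled point `x y⁻¹ y' z⁻¹` lies in the affine slice
`x g⁻¹ 𝔎 g z⁻¹` through the target `x z⁻¹` (inverses of invertible elements of a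
finite-dimensional algebra stay in the algebra). -/
theorem affine_localisation {n : ℕ} (𝔎 : Subalgebra ℂ (Matrix (Fin n) (Fin n) ℂ))
    (g h x z y y' : GLn n)
    (hy : ((g * y * h : GLn n) : Matrix (Fin n) (Fin n) ℂ) ∈ 𝔎)
    (hy' : ((g * y' * h : GLn n) : Matrix (Fin n) (Fin n) ℂ) ∈ 𝔎) :
    ∃ κ ∈ 𝔎, ((x * y⁻¹ * y' * z⁻¹ : GLn n) : Matrix (Fin n) (Fin n) ℂ)
      = (x : Matrix (Fin n) (Fin n) ℂ) * ((g⁻¹ : GLn n) : Matrix (Fin n) (Fin n) ℂ) * κ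
        * (g : Matrix (Fin n) (Fin n) ℂ) * ((z⁻¹ : GLn n) : Matrix (Fin n) (Fin n) ℂ) := by
  sorry

/-- **Transfer C⁺ of card `subalgebra-middle-localisation`**: the crux with the side condition
that the middle set `Y` sits in a two-sided translate of a unital subalgebra of complex dimension
`≤ n²/2` (for even `n` the Levi block algebra `M_{n/2} ⊕ M_{n/2}` is the intended instance). -/
def SubalgebraMiddleDesigns : Prop :=
  ∀ ε : ℝ, 0 < ε → ∃ n : ℕ, 3 ≤ n ∧ ∀ δ : ℝ, 0 < δ → ∀ q₀ : ℕ, ∃ q : ℕ, q₀ ≤ q ∧ ∀ η : ℝ, 0 < η →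
    ∃ X Y Z : Finset (GLn n),
      (∃ 𝔎 : Subalgebra ℂ (Matrix (Fin n) (Fin n) ℂ), ∃ g h : GLn n,
          (Module.finrank ℂ 𝔎 : ℝ) ≤ (n : ℝ) ^ 2 / 2 ∧
          ∀ y ∈ Y, ((g * y * h : GLn n) : Matrix (Fin n) (Fin n) ℂ) ∈ 𝔎) ∧
      (∀ x ∈ X, ∀ x' ∈ X, ∀ y ∈ Y, ∀ y' ∈ Y, ∀ z ∈ Z, ∀ z' ∈ Z,
          x * y⁻¹ * y' * z⁻¹ = x' * z'⁻¹ → x = x' ∧ y = y' ∧ z = z') ∧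
      (q : ℝ) ^ ((n : ℝ) ^ 2 / 2 - ε * n) ≤ (X.card : ℝ) ∧
      (q : ℝ) ^ ((n : ℝ) ^ 2 / 2 - ε * n) ≤ (Y.card : ℝ) ∧
      (q : ℝ) ^ ((n : ℝ) ^ 2 / 2 - ε * n) ≤ (Z.card : ℝ) ∧
      ∀ x₀ ∈ X, ∀ z₀ ∈ Z, ∃ p : MvPolynomial (Fin n × Fin n) ℂ,
        (p.totalDegree : ℝ) ≤ (q : ℝ) ^ (1 + δ) ∧
        ∀ x ∈ X, ∀ y ∈ Y, ∀ y' ∈ Y, ∀ z ∈ Z,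
          ((x = x₀ ∧ y = y' ∧ z = z₀) →
            ‖MvPolynomial.eval (fun ij : Fin n × Fin n =>
              ((x * y⁻¹ * y' * z⁻¹ : GLn n) : Matrix (Fin n) (Fin n) ℂ) ij.1 ij.2) p - 1‖ ≤ η) ∧
          (¬ (x = x₀ ∧ y = y' ∧ z = z₀) →
            ‖MvPolynomial.eval (fun ij : Fin n × Fin n =>
              ((x * y⁻¹ * y' * z⁻¹ : GLn n) : Matrix (Fin n) (Fin n) ℂ) ij.1 ij.2) p‖ ≤ η)

/-- Glue: the transfer implies the crux (drop the side condition). -/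
theorem border_of_subalgebraMiddle (h : SubalgebraMiddleDesigns) :
    Summit.MatrixMultiplication.MatrixMultiplication.Theses.GLnSeparatingDesigns.BorderHalfDimensionDesigns := by
  intro ε hε
  obtain ⟨n, hn, H⟩ := h ε hε
  refine ⟨n, hn, fun δ hδ q₀ => ?_⟩
  obtain ⟨q, hq, Hq⟩ := H δ hδ q₀
  refine ⟨q, hq, fun η hη => ?_⟩
  obtain ⟨X, Y, Z, -, htpp, hX, hY, hZ, hsep⟩ := Hq η hη
  exact ⟨X, Y, Z, htpp, hX, hY, hZ, hsep⟩

/-- **Combinatorial core of the pole-order lemma** (card `lie-patch-pole-order`, first lemma).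
A polynomial in `2m` variables that vanishes on the diagonal of the grid `S^m × S^m`
(`|S| = q ≥ 2`) and equals `-1` at every off-diagonal grid point has total degree
`≥ m (q - 1)`: its reduced representative modulo the grid ideal is `-1 + ∏ᵢ Dᵢ` with
`Dᵢ` the diagonal indicator on `S × S` (degree `≥ q-1` in each pair of variables), and
Gröbner reduction modulo the univariate grid polynomials never raises total degree.
[Alon–Füredi-type degree bound] -/
theorem diagIndicator_totalDegree_le (m q : ℕ) (hq : 2 ≤ q) (hm : 1 ≤ m) (S : Finset ℂ)
    (hS : S.card = q) (G : MvPolynomial (Fin m ⊕ Fin m) ℂ)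
    (hG : ∀ b b' : Fin m → ℂ, (∀ i, b i ∈ S) → (∀ i, b' i ∈ S) →
      MvPolynomial.eval (Sum.elim b b') G = if b = b' then 0 else -1) :
    m * (q - 1) ≤ G.totalDegree := by
  sorry

end Summit.MatrixMultiplication.MatrixMultiplication.Cruxes.BorderHalfDimensionDesigns.Ideate4
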